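import Literature.Analysis.Calculus.NewtonSplitThree
import Literature.Analysis.FunctionSpaces.CompactCutoffExtension
import HarnessLib

/-!
# The split smooth Newton theorem `S₂ ⊂ S₃` — germ form at a point of the wall `x = 0`

Topic `Analysis/Calculus`; cell `pub/hodgecm-mathlib`, N8-INNER brick (10)(A′) «SPLIT NEWTON `S₂ ⊂ S₃`» (offer (o1) of
the (A′) hand).  Count-neutral Literature THEOREMS (`--kind proof --supports stmt-HodgeConjecture-24833`); no `def`, no
instance, no notation, no `sorry`; frame of ★ `NewtonSplitThree`.

The global head ★ `exists_contDiff_newtonSplitThree` wants `g` smooth and `x`-even on ALL of `ℝ × ℝ × ℝ × P`.  A consumer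
at a scalar corner (or at any point of the wall `x = 0`) has `g` smooth and even only on a sup-norm ball
`B((0, θ₀, θ₀′), r)` in the variables `(x, θ, θ′)` (such balls are stable under `x ↦ −x`), times the parameter space.
`exists_contDiff_newtonSplitThree_ball`: then, on a smaller such ball, `g (x, θ, θ′, z) = Σ_{k<3} θ′^k • U_k (e₁, e₂, e₃, z)`
with `U_k` smooth on all of `ℝ × ℝ × ℝ × P` — by the `x`-EVEN cut-off `χ (x, θ, θ′) = β (x², θ, θ′)` (`β` a bump on `ℝ³`)
and the global head applied to `χ • g` (extension by zero, ★ `CompactCutoffExtension.contDiff_smul_of_tsupport_subset`),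
the germ-transfer pattern of ★ `SymmetricGermCutoff`.
HONEST LABEL: count-neutral Mathlib-side analysis; HC_CM is proved only modulo the printed citations (hLiu418 =
`stmt-HodgeConjecture-24832`, h413 = `stmt-HodgeConjecture-24833`) until rung 0 closes.

## References
* [Glaeser1963Newton] G. Glaeser, *Fonctions composées différentiables*, Ann. of Math. 77 (1963) 193–209, Thm. II.
* [GolubitskyGuillemin1973] M. Golubitsky, V. Guillemin, *Stable Mappings and Their Singularities*, GTM 14 (1973),
  Ch. IV §3 Example (B) (cut-off ∕ germ transfer).
-/

noncomputable section

open Set Function Filter Topology Metric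
open scoped ContDiff

namespace Literature.Analysis.Calculus

universe u

variable {P : Type u} [NormedAddCommGroup P] [NormedSpace ℝ P] [FiniteDimensional ℝ P]
  {E : Type u} [NormedAddCommGroup E] [NormedSpace ℝ E] [CompleteSpace E]

omit [FiniteDimensional ℝ P] [CompleteSpace E] in
/-- An `x`-even smooth cut-off on `ℝ × ℝ × ℝ` about a point of the wall `x = 0`: `χ = 1` on the sup-ball of radius `r′`,
`tsupport χ` inside the sup-ball of radius `r`, `χ (−x, θ, θ′) = χ (x, θ, θ′)` — namely `χ (x, θ, θ′) = β (x², θ, θ′)` for a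
bump `β`. [folklore] [cite: GolubitskyGuillemin1973, Ch. IV §3 Example (B)] -/
theorem exists_even_cutoff (θ₀ θ₀' : ℝ) {r : ℝ} (hr : 0 < r) :
    ∃ (χ : ℝ × ℝ × ℝ → ℝ) (r' : ℝ), ContDiff ℝ ∞ χ ∧ 0 < r' ∧
      (∀ w ∈ ball ((0, θ₀, θ₀') : ℝ × ℝ × ℝ) r', χ w = 1) ∧
      tsupport χ ⊆ ball ((0, θ₀, θ₀') : ℝ × ℝ × ℝ) r ∧
      ∀ (x θ θ' : ℝ), χ (-x, θ, θ') = χ (x, θ, θ') := by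
  -- radii: `r₂ < min r (r²)`, `r₁ = r₂ / 2`, `r' = min r₁ 1`
  set r₂ : ℝ := min r (r ^ 2) / 2 with hr₂
  have hr2pos : 0 < r ^ 2 := by positivity
  have hr₂pos : 0 < r₂ := by rw [hr₂]; positivity
  have hr₂r : r₂ < r := by
    rw [hr₂]; linarith [min_le_left r (r ^ 2)]
  have hr₂r2 : r₂ < r ^ 2 := by
    rw [hr₂]; linarith [min_le_right r (r ^ 2)]
  set β : ContDiffBump ((0, θ₀, θ₀') : ℝ × ℝ × ℝ) := ⟨r₂ / 2, r₂, by positivity, by linarith⟩ with hβ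
  refine ⟨fun w => β (w.1 ^ 2, w.2.1, w.2.2), min (r₂ / 2) 1, ?_, by positivity, ?_, ?_, ?_⟩
  · exact β.contDiff.comp (by fun_prop)
  · intro w hw
    apply β.one_of_mem_closedBall
    rw [mem_ball, Prod.dist_eq, Prod.dist_eq, max_lt_iff, max_lt_iff] at hw
    obtain ⟨h1, h2, h3⟩ := hw
    have h1' : |w.1| < min (r₂ / 2) 1 := by simpa [Real.dist_eq] using h1
    have hx1 : |w.1| < 1 := lt_of_lt_of_le h1' (min_le_right _ _)
    have hx2 : |w.1| < r₂ / 2 := lt_of_lt_of_le h1' (min_le_left _ _)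
    rw [mem_closedBall, Prod.dist_eq, Prod.dist_eq]
    refine max_le ?_ (max_le ?_ ?_)
    · show dist (w.1 ^ 2) 0 ≤ β.rIn
      rw [Real.dist_eq, sub_zero, abs_pow]
      calc |w.1| ^ 2 = |w.1| * |w.1| := sq _
        _ ≤ |w.1| * 1 := mul_le_mul_of_nonneg_left hx1.le (abs_nonneg _)
        _ ≤ r₂ / 2 := by linarith
    · exact (lt_of_lt_of_le h2 (min_le_left _ _)).le
    · exact (lt_of_lt_of_le h3 (min_le_left _ _)).le
  · -- `tsupport (β ∘ m) ⊆ m ⁻¹' (tsupport β) = m ⁻¹' closedBall _ r₂ ⊆ ball _ r`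
    have hm : Continuous fun w : ℝ × ℝ × ℝ => ((w.1 ^ 2, w.2.1, w.2.2) : ℝ × ℝ × ℝ) := by fun_prop
    refine (closure_minimal ?_ ((isClosed_tsupport β).preimage hm)).trans ?_
    · intro w hw
      exact subset_tsupport _ (mem_support.2 (mem_support.1 hw))
    · intro w hw
      rw [mem_preimage, β.tsupport_eq, mem_closedBall, Prod.dist_eq, Prod.dist_eq, max_le_iff, max_le_iff] at hw
      obtain ⟨h1, h2, h3⟩ := hw
      change dist (w.1 ^ 2) 0 ≤ r₂ at h1
      rw [Real.dist_eq, sub_zero, abs_pow] at h1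
      rw [mem_ball, Prod.dist_eq, Prod.dist_eq, max_lt_iff, max_lt_iff]
      refine ⟨?_, lt_of_le_of_lt h2 hr₂r, lt_of_le_of_lt h3 hr₂r⟩
      show dist w.1 0 < r
      rw [Real.dist_eq, sub_zero]
      have : |w.1| ^ 2 < r ^ 2 := lt_of_le_of_lt h1 hr₂r2
      exact lt_of_pow_lt_pow_left₀ 2 hr.le this
  · intro x θ θ'
    simp only [neg_sq]

/-- **Split smooth Newton theorem, germ form at a point of the wall `x = 0`.**  If `g : ℝ × ℝ × ℝ × P → E` is smooth on
(the preimage of) a sup-ball `B((0, θ₀, θ₀′), r)` in `(x, θ, θ′)` times `P`, and even in `x` there, then on a smaller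
sup-ball `g (x, θ, θ′, z) = Σ_{k<3} θ′^k • U_k (2θ+θ′, θ²+x²+2θθ′, (θ²+x²)θ′, z)` with `U₀, U₁, U₂` smooth on all of
`ℝ × ℝ × ℝ × P`.  (★ `exists_contDiff_newtonSplitThree` applied to the `x`-even cut-off product.)
[cite: Glaeser1963Newton, Thm. II] [cite: GolubitskyGuillemin1973, Ch. IV §3 Example (B)] -/
theorem exists_contDiff_newtonSplitThree_ball (g : ℝ × ℝ × ℝ × P → E) (θ₀ θ₀' : ℝ) {r : ℝ} (hr : 0 < r)
    (hg : ContDiffOn ℝ ∞ g {q : ℝ × ℝ × ℝ × P | ((q.1, q.2.1, q.2.2.1) : ℝ × ℝ × ℝ) ∈ ball ((0, θ₀, θ₀') : ℝ × ℝ × ℝ) r})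
    (heven : ∀ (x θ θ' : ℝ) (z : P), ((x, θ, θ') : ℝ × ℝ × ℝ) ∈ ball ((0, θ₀, θ₀') : ℝ × ℝ × ℝ) r →
      g (-x, θ, θ', z) = g (x, θ, θ', z)) :
    ∃ U : Fin 3 → ℝ × ℝ × ℝ × P → E, (∀ k, ContDiff ℝ ∞ (U k)) ∧ ∃ r' > 0,
      ∀ (x θ θ' : ℝ) (z : P), ((x, θ, θ') : ℝ × ℝ × ℝ) ∈ ball ((0, θ₀, θ₀') : ℝ × ℝ × ℝ) r' →
        g (x, θ, θ', z) =
          ∑ k : Fin 3, θ' ^ (k : ℕ) • U k (2 * θ + θ', θ ^ 2 + x ^ 2 + 2 * θ * θ', (θ ^ 2 + x ^ 2) * θ', z) := by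
  obtain ⟨χ, r', hχs, hr', hχ1, hχsupp, hχeven⟩ := exists_even_cutoff θ₀ θ₀' hr
  -- the cut-off product, extended by zero
  set F : ℝ × ℝ × ℝ × P → E := fun q => χ (q.1, q.2.1, q.2.2.1) • g q with hF
  have hO : IsOpen {q : ℝ × ℝ × ℝ × P | ((q.1, q.2.1, q.2.2.1) : ℝ × ℝ × ℝ) ∈ ball ((0, θ₀, θ₀') : ℝ × ℝ × ℝ) r} :=
    isOpen_ball.preimage (by fun_prop)
  have hFs : ContDiff ℝ ∞ F := by
    refine Literature.Analysis.FunctionSpaces.contDiff_smul_of_tsupport_subset hO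
      (hχs.comp (by fun_prop)) ?_ hg
    -- `tsupport (χ ∘ m) ⊆ m ⁻¹' tsupport χ ⊆ O`
    have hm : Continuous fun q : ℝ × ℝ × ℝ × P => ((q.1, q.2.1, q.2.2.1) : ℝ × ℝ × ℝ) := by fun_prop
    refine (closure_minimal ?_ ((isClosed_tsupport χ).preimage hm)).trans fun q hq => hχsupp hq
    intro q hq
    exact subset_tsupport _ (mem_support.2 (mem_support.1 hq))
  have hFeven : ∀ (x θ θ' : ℝ) (z : P), F (-x, θ, θ', z) = F (x, θ, θ', z) := by
    intro x θ θ' z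
    simp only [hF, hχeven]
    by_cases hx : ((x, θ, θ') : ℝ × ℝ × ℝ) ∈ ball ((0, θ₀, θ₀') : ℝ × ℝ × ℝ) r
    · rw [heven x θ θ' z hx]
    · have h0 : χ (x, θ, θ') = 0 := by
        by_contra h
        exact hx (hχsupp (subset_tsupport _ (mem_support.2 h)))
      rw [h0, zero_smul, zero_smul]
  obtain ⟨U, hU, hUF⟩ := exists_contDiff_newtonSplitThree F hFs hFeven
  refine ⟨U, hU, r', hr', fun x θ θ' z hx => ?_⟩
  rw [← hUF x θ θ' z, hF]
  simp only [hχ1 _ hx, one_smul]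

/-- **Light-cone form, germ version at a point of the diagonal `p = q`.**  If `Φ : ℝ × ℝ × P → E` is smooth on (the
preimage of) a sup-ball `B((a, a), r)` in `(p, q)` times `P` and symmetric there (`Φ (q, p, z) = Φ (p, q, z)`), then on a
smaller sup-ball `Φ (p, q, z) = Σ_{k<3} (p+q)^k • G_k (pq, (p³+q³)/2, z)` with `G_k` smooth everywhere — from the
`(x, θ, θ′)`-germ form through `x = (p − q)/(2√3)`-free bookkeeping: here directly by the symmetric cut-off
`χ (p, q) = β ((p−q)², p+q)` and the global head ★ `exists_contDiff_comp_splitInvariants_of_swap`.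
[cite: Glaeser1963Newton, Thm. II] [cite: GolubitskyGuillemin1973, Ch. IV §3 Example (B)] -/
theorem exists_contDiff_comp_splitInvariants_of_swap_ball (Φ : ℝ × ℝ × P → E) (a : ℝ) {r : ℝ} (hr : 0 < r)
    (hΦ : ContDiffOn ℝ ∞ Φ {q : ℝ × ℝ × P | ((q.1, q.2.1) : ℝ × ℝ) ∈ ball ((a, a) : ℝ × ℝ) r})
    (hswap : ∀ (p q : ℝ) (z : P), ((p, q) : ℝ × ℝ) ∈ ball ((a, a) : ℝ × ℝ) r → Φ (q, p, z) = Φ (p, q, z)) :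
    ∃ G : Fin 3 → ℝ × ℝ × P → E, (∀ k, ContDiff ℝ ∞ (G k)) ∧ ∃ r' > 0,
      ∀ (p q : ℝ) (z : P), ((p, q) : ℝ × ℝ) ∈ ball ((a, a) : ℝ × ℝ) r' →
        Φ (p, q, z) = ∑ k : Fin 3, (p + q) ^ (k : ℕ) • G k (p * q, (p ^ 3 + q ^ 3) / 2, z) := by
  -- even cut-off in the variables `(x, θ, θ′) := (p − q, p + q, 0)`-style: use `exists_even_cutoff` on `(p − q, p + q)`
  obtain ⟨χ, r', hχs, hr', hχ1, hχsupp, hχeven⟩ := exists_even_cutoff (2 * a) 0 (r := r) hr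
  -- `ψ (p, q) := χ (p − q, p + q, 0)`: symmetric, `= 1` near `(a, a)`, supported in the ball of radius `r`
  set ψ : ℝ × ℝ → ℝ := fun w => χ (w.1 - w.2, w.1 + w.2, 0) with hψ
  have hψs : ContDiff ℝ ∞ ψ := hχs.comp (by fun_prop)
  have hψsymm : ∀ p q : ℝ, ψ (q, p) = ψ (p, q) := by
    intro p q
    simp only [hψ]
    rw [show q - p = -(p - q) by ring, hχeven, add_comm q p]
  have hψ1 : ∀ w ∈ ball ((a, a) : ℝ × ℝ) (r' / 2), ψ w = 1 := by
    intro w hw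
    apply hχ1
    rw [mem_ball, Prod.dist_eq, max_lt_iff, Real.dist_eq, Real.dist_eq] at hw
    rw [mem_ball, Prod.dist_eq, Prod.dist_eq, max_lt_iff, max_lt_iff, Real.dist_eq, Real.dist_eq, Real.dist_eq,
      sub_zero, sub_self, abs_zero]
    refine ⟨?_, ?_, hr'⟩
    · calc |w.1 - w.2| = |(w.1 - a) - (w.2 - a)| := by ring_nf
        _ ≤ |w.1 - a| + |w.2 - a| := abs_sub _ _
        _ < r' / 2 + r' / 2 := add_lt_add hw.1 hw.2
        _ = r' := by ring
    · calc |w.1 + w.2 - 2 * a| = |(w.1 - a) + (w.2 - a)| := by ring_nf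
        _ ≤ |w.1 - a| + |w.2 - a| := abs_add_le _ _
        _ < r' / 2 + r' / 2 := add_lt_add hw.1 hw.2
        _ = r' := by ring
  have hψsupp : ∀ w : ℝ × ℝ, ψ w ≠ 0 → w ∈ ball ((a, a) : ℝ × ℝ) r := by
    intro w hw
    have hmem := hχsupp (subset_tsupport _ (mem_support.2 hw))
    rw [mem_ball, Prod.dist_eq, Prod.dist_eq, max_lt_iff, max_lt_iff, Real.dist_eq, Real.dist_eq] at hmem
    obtain ⟨h1, h2, -⟩ := hmem
    rw [sub_zero] at h1
    rw [mem_ball, Prod.dist_eq, max_lt_iff, Real.dist_eq, Real.dist_eq]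
    constructor
    · have : |2 * (w.1 - a)| < 2 * r := by
        calc |2 * (w.1 - a)| = |(w.1 - w.2) + (w.1 + w.2 - 2 * a)| := by ring_nf
          _ ≤ |w.1 - w.2| + |w.1 + w.2 - 2 * a| := abs_add_le _ _
          _ < r + r := add_lt_add h1 h2
          _ = 2 * r := by ring
      rw [abs_mul, abs_of_pos (by norm_num : (0:ℝ) < 2)] at this
      linarith
    · have : |2 * (w.2 - a)| < 2 * r := by
        calc |2 * (w.2 - a)| = |(w.1 + w.2 - 2 * a) - (w.1 - w.2)| := by ring_nf
          _ ≤ |w.1 + w.2 - 2 * a| + |w.1 - w.2| := abs_sub _ _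
          _ < r + r := add_lt_add h2 h1
          _ = 2 * r := by ring
      rw [abs_mul, abs_of_pos (by norm_num : (0:ℝ) < 2)] at this
      linarith
  -- the cut-off product
  set F : ℝ × ℝ × P → E := fun q => ψ (q.1, q.2.1) • Φ q with hF
  have hO : IsOpen {q : ℝ × ℝ × P | ((q.1, q.2.1) : ℝ × ℝ) ∈ ball ((a, a) : ℝ × ℝ) r} :=
    isOpen_ball.preimage (by fun_prop)
  have hFs : ContDiff ℝ ∞ F := by
    refine Literature.Analysis.FunctionSpaces.contDiff_smul_of_tsupport_subset hO
      (hψs.comp (by fun_prop)) ?_ hΦ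
    have hm : Continuous fun q : ℝ × ℝ × P => ((q.1, q.2.1) : ℝ × ℝ) := by fun_prop
    have hcl : tsupport (fun q : ℝ × ℝ × P => ψ (q.1, q.2.1)) ⊆
        (fun q : ℝ × ℝ × P => ((q.1, q.2.1) : ℝ × ℝ)) ⁻¹' tsupport ψ :=
      closure_minimal (fun q hq => subset_tsupport _ (mem_support.2 (mem_support.1 hq)))
        ((isClosed_tsupport ψ).preimage hm)
    refine hcl.trans fun q hq => ?_
    -- `tsupport ψ ⊆ closedBall (a,a) ?` is not needed: `tsupport ψ ⊆ closure (ball) `; use the closed sup-ball of radius `< r`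
    -- via `hχsupp`: points of `tsupport ψ` are limits of points of `support ψ ⊆ ball _ r`… we argue through `χ` directly:
    have hq' : (q.1 - q.2.1, q.1 + q.2.1, (0:ℝ)) ∈ tsupport χ := by
      have hcont : Continuous fun w : ℝ × ℝ => ((w.1 - w.2, w.1 + w.2, (0:ℝ)) : ℝ × ℝ × ℝ) := by fun_prop
      have hsub : tsupport ψ ⊆ (fun w : ℝ × ℝ => ((w.1 - w.2, w.1 + w.2, (0:ℝ)) : ℝ × ℝ × ℝ)) ⁻¹' tsupport χ :=
        closure_minimal (fun w hw => subset_tsupport _ (mem_support.2 (mem_support.1 hw)))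
          ((isClosed_tsupport χ).preimage hcont)
      exact hsub hq
    have hmem := hχsupp hq'
    rw [mem_ball, Prod.dist_eq, Prod.dist_eq, max_lt_iff, max_lt_iff, Real.dist_eq, Real.dist_eq] at hmem
    obtain ⟨h1, h2, -⟩ := hmem
    rw [sub_zero] at h1
    show ((q.1, q.2.1) : ℝ × ℝ) ∈ ball ((a, a) : ℝ × ℝ) r
    rw [mem_ball, Prod.dist_eq, max_lt_iff, Real.dist_eq, Real.dist_eq]
    constructor
    · have : |2 * (q.1 - a)| < 2 * r := by
        calc |2 * (q.1 - a)| = |(q.1 - q.2.1) + (q.1 + q.2.1 - 2 * a)| := by ring_nf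
          _ ≤ |q.1 - q.2.1| + |q.1 + q.2.1 - 2 * a| := abs_add_le _ _
          _ < r + r := add_lt_add h1 h2
          _ = 2 * r := by ring
      rw [abs_mul, abs_of_pos (by norm_num : (0:ℝ) < 2)] at this
      linarith
    · have : |2 * (q.2.1 - a)| < 2 * r := by
        calc |2 * (q.2.1 - a)| = |(q.1 + q.2.1 - 2 * a) - (q.1 - q.2.1)| := by ring_nf
          _ ≤ |q.1 + q.2.1 - 2 * a| + |q.1 - q.2.1| := abs_sub _ _
          _ < r + r := add_lt_add h2 h1
          _ = 2 * r := by ring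
      rw [abs_mul, abs_of_pos (by norm_num : (0:ℝ) < 2)] at this
      linarith
  have hFswap : ∀ (p q : ℝ) (z : P), F (q, p, z) = F (p, q, z) := by
    intro p q z
    simp only [hF, hψsymm p q]
    by_cases hw : ((p, q) : ℝ × ℝ) ∈ ball ((a, a) : ℝ × ℝ) r
    · rw [hswap p q z hw]
    · have h0 : ψ (p, q) = 0 := by
        by_contra h
        exact hw (hψsupp _ h)
      rw [h0, zero_smul, zero_smul]
  obtain ⟨G, hG, hGF⟩ := exists_contDiff_comp_splitInvariants_of_swap F hFs hFswap
  refine ⟨G, hG, r' / 2, by positivity, fun p q z hw => ?_⟩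
  rw [← hGF p q z, hF]
  simp only [hψ1 _ hw, one_smul]

end Literature.Analysis.Calculus

end
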